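import Summits.QuantumAdvantage.QuantumAdvantage.Theorems.SosSandwichPseudoBoundedAAClassicalCorner
import Summits.QuantumAdvantage.QuantumAdvantage.Theorems.SosSandwichMeanSquareAlg
import HarnessLib

/-!
# Crux `PseudoBoundedAA` (stmt-QuantumAdvantage-15237, route SosSandwich) — the classical corner misses `Q_1`:
# the one-query Deutsch–Jozsa mean-square polynomial is NOT a mixture of decision trees of depth `≤ N/2`

File 7 of the CLASSICAL CORNER of PB-AA (files 1–6: the `(2,2)` law `16·Var² ≤ D̄²·maxInf` on the cone `R_T ⊆ K_T` of
acceptance probabilities of randomized classical `T`-query algorithms, its `PMF` / robust / real-tree / expected-cost forms,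
and the kernel equivalence PB-AA ⟺ randomized shallow `L²`-approximation).  How much of the sandwich class does the
classical corner cover?  Not even its one-query quantum members: the acceptance probability of the one-query mean algorithm
`meanAlg N` of the tree (`MeanSquareAlg.meanAlg_acceptProb`: `((1/N)·Σ_k (−1)^{x_k})²`, Deutsch–Jozsa) vanishes exactly on
the balanced inputs, and

* `eval_eq_false_of_balanced` — a decision tree of depth `≤ d` that rejects every BALANCED input consistent with a partial
  assignment (`A` forced to `1`, `B` forced to `0`, `2(|A ∪ B| + d) ≤ N`) rejects every consistent input (induction on the
  tree: every root-to-leaf path of length `≤ N/2 − |A ∪ B|` is followed by a balanced input — `exists_balanced_consistent`,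
  via `Finset.exists_subsuperset_card_eq`);
* **`meanSquare_not_mixture`** — for even `N = 2n ≥ 2` and `T ≤ n`, NO finite mixture of decision trees of depth `≤ T`
  with nonnegative weights has acceptance probability `((1/N)·Σ_k (−1)^{x_k})²` on the cube (each tree in the support
  would reject all balanced inputs, hence everything, while the polynomial is `1` at the all-zero input);
* `meanAlg_not_classicalCorner` — hence `Q_1 ⊄ R_T` for every `T ≤ N/2`: the classical corner of PB-AA (where the
  `(2,2)` law is now a theorem) is a PROPER sub-cone of `K_1 ∩ {quantum}` already, the exact Deutsch–Jozsa separation in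
  the crux's vocabulary.

Honest label: calibration of a corner (known separation, Deutsch–Jozsa 1992, in kernel); no stub, crux or summit is closed.
Sources: D. Deutsch, R. Jozsa, Proc. R. Soc. A 439 (1992); R. Cleve, A. Ekert, C. Macchiavello, M. Mosca, Proc. R. Soc. A
454 (1998) (one-query mean amplitude); Beals et al. 2001 §2; Aaronson–Ambainis arXiv:0911.0996 Conj. 6.
-/

set_option linter.dupNamespace false

noncomputable section

namespace Summit.QuantumAdvantage.QuantumAdvantage.Theorems.SosSandwich

open Finset Function
open Literature.Computability.Complexity Literature.Computability.QuantumComplexity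
open Literature.Probability.RandomGraphs.LowDegree (sgn)

namespace ClassicalCorner

variable {N : ℕ}

/-! ### Balanced inputs and consistent completions -/

/-- The sign sum of an input counts zeros minus ones: `Σ_k (−1)^{x_k} = N − 2·#{k | x_k = 1}`. [folklore] -/
theorem sum_sgn_eq (x : Fin N → Bool) :
    ∑ k, sgn (x k) = (N : ℝ) - 2 * ((Finset.univ.filter fun k => x k = true).card : ℝ) := by
  classical
  have h : ∀ k : Fin N, sgn (x k) = 1 - 2 * (if x k = true then (1 : ℝ) else 0) := by
    intro k; cases x k <;> norm_num [sgn]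
  rw [Finset.sum_congr rfl fun k _ => h k, Finset.sum_sub_distrib, ← Finset.mul_sum, Finset.sum_boole,
    Finset.sum_const, Finset.card_univ, Fintype.card_fin]
  simp

/-- **Balanced consistent completion.** If `A` (forced ones) and `B` (forced zeros) are disjoint with `2|A| ≤ N`,
`2|B| ≤ N` and `N` even, some input with exactly `N/2` ones contains `A` among its ones and avoids `B`.
[folklore] -/
theorem exists_balanced_consistent {n : ℕ} (hN : N = 2 * n) (A B : Finset (Fin N)) (hAB : Disjoint A B)
    (hA : A.card ≤ n) (hB : B.card ≤ n) :
    ∃ x : Fin N → Bool, (∀ k ∈ A, x k = true) ∧ (∀ k ∈ B, x k = false) ∧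
      (Finset.univ.filter fun k => x k = true).card = n := by
  classical
  have hsub : A ⊆ Finset.univ \ B := by
    intro k hk
    rw [Finset.mem_sdiff]
    exact ⟨Finset.mem_univ _, Finset.disjoint_left.mp hAB hk⟩
  have hcard : n ≤ (Finset.univ \ B).card := by
    rw [Finset.card_sdiff_of_subset (Finset.subset_univ B), Finset.card_univ, Fintype.card_fin]
    omega
  obtain ⟨S, hAS, hSB, hS⟩ := Finset.exists_subsuperset_card_eq hsub hA hcard
  refine ⟨fun k => decide (k ∈ S), fun k hk => by simpa using hAS hk, fun k hk => ?_, ?_⟩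
  · have : k ∉ S := fun hkS => by
      have := hSB hkS
      rw [Finset.mem_sdiff] at this
      exact this.2 hk
    simpa using this
  · have hfilter : (Finset.univ.filter fun k => decide (k ∈ S) = true) = S := by
      ext k; simp
    rw [hfilter, hS]

/-- **A shallow tree that rejects every balanced consistent input rejects every consistent input.** For a decision tree
`t` and disjoint `A` (forced ones), `B` (forced zeros) with `2(|A| + |B| + depth t) ≤ N`, `N = 2n`: if `t` rejects every
input with exactly `n` ones that is `1` on `A` and `0` on `B`, then `t` rejects EVERY input that is `1` on `A` and `0` on
`B` (every root-to-leaf path is followed by a balanced input). [folklore] -/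
theorem eval_eq_false_of_balanced {n : ℕ} (hN : N = 2 * n) (t : DecisionTree N) :
    ∀ (A B : Finset (Fin N)), Disjoint A B → 2 * (A.card + B.card + t.depth) ≤ N →
      (∀ x : Fin N → Bool, (∀ k ∈ A, x k = true) → (∀ k ∈ B, x k = false) →
        (Finset.univ.filter fun k => x k = true).card = n → t.eval x = false) →
      ∀ x : Fin N → Bool, (∀ k ∈ A, x k = true) → (∀ k ∈ B, x k = false) → t.eval x = false := by
  classical
  induction t with
  | leaf b =>
    intro A B hAB hcard hrej x _ _
    obtain ⟨y, hyA, hyB, hybal⟩ := exists_balanced_consistent hN A B hAB (by omega) (by omega)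
    have hb : b = false := by simpa using hrej y hyA hyB hybal
    simp [hb]
  | query i t₀ t₁ ih₀ ih₁ =>
    intro A B hAB hcard hrej x hxA hxB
    rw [DecisionTree.depth_query] at hcard
    rw [DecisionTree.eval_query]
    by_cases hiA : i ∈ A
    · -- forced one: the tree behaves as `t₁`
      rw [if_pos (hxA i hiA)]
      refine ih₁ A B hAB (by have := le_max_right t₀.depth t₁.depth; omega) (fun y hyA hyB hybal => ?_) x hxA hxB
      have := hrej y hyA hyB hybal
      rw [DecisionTree.eval_query, if_pos (hyA i hiA)] at this
      exact this
    by_cases hiB : i ∈ B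
    · -- forced zero: the tree behaves as `t₀`
      have hxi : ¬ (x i = true) := by rw [hxB i hiB]; decide
      rw [if_neg hxi]
      refine ih₀ A B hAB (by have := le_max_left t₀.depth t₁.depth; omega) (fun y hyA hyB hybal => ?_) x hxA hxB
      have := hrej y hyA hyB hybal
      have hyi : ¬ (y i = true) := by rw [hyB i hiB]; decide
      rw [DecisionTree.eval_query, if_neg hyi] at this
      exact this
    -- fresh variable: extend the partial assignment by the branch taken
    rcases Bool.eq_false_or_eq_true (x i) with hx | hx
    · rw [if_pos hx]
      have hAB' : Disjoint (insert i A) B := by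
        rw [Finset.disjoint_insert_left]; exact ⟨hiB, hAB⟩
      have hcard' : 2 * ((insert i A).card + B.card + t₁.depth) ≤ N := by
        rw [Finset.card_insert_of_notMem hiA]
        have := le_max_right t₀.depth t₁.depth; omega
      refine ih₁ (insert i A) B hAB' hcard' (fun y hyA hyB hybal => ?_) x
        (fun k hk => by
          rcases Finset.mem_insert.mp hk with rfl | hk
          · exact hx
          · exact hxA k hk) hxB
      have hyi : y i = true := hyA i (Finset.mem_insert_self i A)
      have := hrej y (fun k hk => hyA k (Finset.mem_insert_of_mem hk)) hyB hybal
      rw [DecisionTree.eval_query, if_pos hyi] at this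
      exact this
    · have hx' : ¬ (x i = true) := by rw [hx]; decide
      rw [if_neg hx']
      have hAB' : Disjoint A (insert i B) := by
        rw [Finset.disjoint_insert_right]; exact ⟨hiA, hAB⟩
      have hcard' : 2 * (A.card + (insert i B).card + t₀.depth) ≤ N := by
        rw [Finset.card_insert_of_notMem hiB]
        have := le_max_left t₀.depth t₁.depth; omega
      refine ih₀ A (insert i B) hAB' hcard' (fun y hyA hyB hybal => ?_) x hxA
        (fun k hk => by
          rcases Finset.mem_insert.mp hk with rfl | hk
          · exact hx
          · exact hxB k hk)
      have hyi : ¬ (y i = true) := by rw [hyB i (Finset.mem_insert_self i B)]; decide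
      have := hrej y hyA (fun k hk => hyB k (Finset.mem_insert_of_mem hk)) hybal
      rw [DecisionTree.eval_query, if_neg hyi] at this
      exact this

/-! ### The mean-square (Deutsch–Jozsa) polynomial is outside the classical corner up to depth `N/2` -/

/-- **The one-query mean-square polynomial is not a mixture of shallow decision trees.** For even `N = 2n ≥ 2` and
`T ≤ n`, no finite family of decision trees of depth `≤ T` with nonnegative weights has acceptance probability
`x ↦ ((1/N)·Σ_k (−1)^{x_k})²` on the cube: that polynomial vanishes exactly on balanced inputs, so every weighted tree
rejects all balanced inputs, hence (by `eval_eq_false_of_balanced`) all inputs — but the polynomial is `1` at the all-zero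
input. [cite: DeutschJozsa1992] [cite: BealsEtAl2001, §2] -/
theorem meanSquare_not_mixture {n : ℕ} (hn : 1 ≤ n) (hN : N = 2 * n) {T : ℕ} (hT : T ≤ n) :
    ¬ ∃ (m : ℕ) (w : Fin m → ℝ) (t : Fin m → DecisionTree N), (∀ k, 0 ≤ w k) ∧ (∀ k, (t k).depth ≤ T) ∧
      ∀ x : Fin N → Bool, (∑ k, sgn (x k)) ^ 2 / (N : ℝ) ^ 2 =
        ∑ k, w k * (if (t k).eval x = true then (1 : ℝ) else 0) := by
  classical
  rintro ⟨m, w, t, hw, hdepth, hacc⟩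
  -- every weighted tree rejects all balanced inputs
  have hbal0 : ∀ x : Fin N → Bool, (Finset.univ.filter fun k => x k = true).card = n →
      ∀ k, w k * (if (t k).eval x = true then (1 : ℝ) else 0) = 0 := by
    intro x hx
    have hsum0 : ∑ k, w k * (if (t k).eval x = true then (1 : ℝ) else 0) = 0 := by
      rw [← hacc x, sum_sgn_eq x, hx, hN]
      push_cast; ring
    have hnn : ∀ k ∈ (Finset.univ : Finset (Fin m)), 0 ≤ w k * (if (t k).eval x = true then (1 : ℝ) else 0) :=
      fun k _ => mul_nonneg (hw k) (by split_ifs <;> norm_num)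
    intro k
    exact (Finset.sum_eq_zero_iff_of_nonneg hnn).mp hsum0 k (Finset.mem_univ k)
  -- hence every weighted tree rejects everything
  have hall : ∀ (x : Fin N → Bool) (k : Fin m), w k * (if (t k).eval x = true then (1 : ℝ) else 0) = 0 := by
    intro x k
    rcases (hw k).lt_or_eq with hpos | hzero
    · have hrej : ∀ y : Fin N → Bool, (∀ j ∈ (∅ : Finset (Fin N)), y j = true) →
          (∀ j ∈ (∅ : Finset (Fin N)), y j = false) →
          (Finset.univ.filter fun j => y j = true).card = n → (t k).eval y = false := by
        intro y _ _ hybal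
        have h0 := hbal0 y hybal k
        rcases mul_eq_zero.mp h0 with hw0 | hF0
        · exact absurd hw0 (ne_of_gt hpos)
        · by_contra hne
          rw [Bool.not_eq_false] at hne
          rw [if_pos hne] at hF0
          exact one_ne_zero hF0
      have hfalse := eval_eq_false_of_balanced hN (t k) ∅ ∅ (Finset.disjoint_empty_left _)
        (by simp; have := hdepth k; omega) hrej x (by simp) (by simp)
      simp [hfalse]
    · rw [← hzero, zero_mul]
  -- but the all-zero input has acceptance probability `1`
  have h1 := hacc (fun _ => false)
  rw [Finset.sum_congr rfl fun k _ => hall (fun _ => false) k, Finset.sum_const_zero] at h1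
  have hN0 : (N : ℝ) ≠ 0 := by
    have : N ≠ 0 := by omega
    exact_mod_cast this
  simp only [Literature.Probability.RandomGraphs.LowDegree.sgn_false, Finset.sum_const, Finset.card_univ,
    Fintype.card_fin, nsmul_eq_mul, mul_one] at h1
  rw [div_eq_zero_iff] at h1
  rcases h1 with h1 | h1
  · exact hN0 (pow_eq_zero_iff two_ne_zero |>.mp h1)
  · exact hN0 (pow_eq_zero_iff two_ne_zero |>.mp h1)

/-- **`Q_1 ⊄ R_T` for `T ≤ N/2` (exact Deutsch–Jozsa separation, in the crux's vocabulary).** For even `N = 2n ≥ 2` and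
`T ≤ n`, the acceptance probability of the tree's ONE-query quantum mean algorithm `MeanSquareAlg.meanAlg N` is not the
acceptance probability of any finite mixture of classical decision trees of depth `≤ T` — the classical corner of PB-AA
(files 1–6) is a proper sub-cone of the sandwich class that misses `Q_1`. [cite: DeutschJozsa1992]
[cite: BealsEtAl2001, §2] [cite: AaronsonAmbainis2014, Conj. 6] -/
theorem meanAlg_not_classicalCorner {n : ℕ} (hn : 1 ≤ n) (hN : N = 2 * n) {T : ℕ} (hT : T ≤ n) (h1N : 1 ≤ N) :
    ¬ ∃ (m : ℕ) (w : Fin m → ℝ) (t : Fin m → DecisionTree N), (∀ k, 0 ≤ w k) ∧ (∀ k, (t k).depth ≤ T) ∧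
      ∀ x : Fin N → Bool, (MeanSquareAlg.meanAlg N h1N).acceptProb x =
        ∑ k, w k * (if (t k).eval x = true then (1 : ℝ) else 0) := by
  rintro ⟨m, w, t, hw, hdepth, hacc⟩
  refine meanSquare_not_mixture hn hN hT ⟨m, w, t, hw, hdepth, fun x => ?_⟩
  rw [← MeanSquareAlg.meanAlg_acceptProb h1N x]
  exact hacc x

end ClassicalCorner

end Summit.QuantumAdvantage.QuantumAdvantage.Theorems.SosSandwich

end
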